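import Mathlib
import Literature.Computability.AlgebraicComplexity.MultiplicityObstructionsProofs
import Literature.NumberTheory.DiophantineGeometry.SchurWeylPlethysmOrbitWeightsProofs

/-!
# Evaluation certificates exist in the size of the multiplicity (crux `ValuativeGCT.ValuativeFlip`,
# stmt-ValiantsHypothesis-12624) — size-transfer axis, part IVb

Wall-breaker k12/16, 2026-08-16.  The COMPLETENESS half of the certificate currency used by the siege's tail
programme and by eventual inheritance (`…EventualInheritance`): the converse of the engine
`stub_evalRankLowerBound` (k3, `…EvalRankLowerBoundK3`).

* `exists_det_eval_ne_zero_of_linearIndependent` — ALTERNANT LEMMA: linearly independent functions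
  `φ₀, …, φ_{D-1} : X → K` admit points `x₀, …, x_{D-1}` with `det (φ_i(x_l)) ≠ 0` (induction on `D`,
  cofactor expansion along the new column);
* `exists_certificate_orbitMultiplicity` — for any form `f` in variables `σ`, `m ≠ 0` and weight `χ`, the
  multiplicity `D = mult_χ ℂ[Δ_m(f)]` is witnessed by highest-weight vectors `F₁ … F_D ∈ ℂ[Sym^m ℂ^σ]` of weight
  `χ` and matrices `A₁ … A_D` (possibly singular) with nonsingular evaluation matrix `(F_i(A_l · f))`: lift a basis
  of the highest-weight space of `ℂ[Δ_m(f)]` (complete reducibility, `map_highestWeightSpace_eq_of_surjective`);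
  the functions `A ↦ F_i(A · f)` are linearly independent because a vanishing combination lies in `I(GL · f)`.

(k4 gen1 registered the variant with INVERTIBLE points, `exists_evalCertificate_of_le_orbitMultiplicity`; for
transport along the padding singular points are as good.)  Sources: Mulmuley–Sohoni 2001 §4–5; Bläser–Ikenmeyer
2025 §12.4; folklore.
-/

set_option linter.dupNamespace false

namespace Summit.ValiantsHypothesis.ValiantsHypothesis.Theorems.ValuativeFlip

open scoped BigOperators
open MvPolynomial
open Literature.NumberTheory.DiophantineGeometry
open Literature.Computability.AlgebraicComplexity

noncomputable section

/-! ## Linearly independent functions have a nonsingular evaluation matrix -/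

/-- **Alternant lemma.**  If `φ₀, …, φ_{D-1} : X → K` are linearly independent functions, there are points
`x₀, …, x_{D-1}` with `det (φ_i(x_l)) ≠ 0` (induction on `D`, expanding along the new column: the cofactor
of the new point in row `0` is the previous nonzero minor, so `x ↦ det` is a nontrivial combination of the
`φ_i`, hence not identically zero). [folklore] -/
theorem exists_det_eval_ne_zero_of_linearIndependent {K X : Type*} [Field K] :
    ∀ (D : ℕ) (φ : Fin D → X → K), LinearIndependent K φ →
      ∃ x : Fin D → X, (Matrix.of fun i l : Fin D => φ i (x l)).det ≠ 0
  | 0, φ, _ => ⟨Fin.elim0, by simp [Matrix.det_isEmpty]⟩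
  | D + 1, φ, hφ => by
    classical
    -- previous step on the tail
    have htail : LinearIndependent K (fun i : Fin D => φ i.succ) :=
      hφ.comp Fin.succ (Fin.succ_injective D)
    obtain ⟨x', hx'⟩ := exists_det_eval_ne_zero_of_linearIndependent D (fun i => φ i.succ) htail
    -- the determinant with a variable first column
    let N : X → Matrix (Fin (D + 1)) (Fin (D + 1)) K := fun x =>
      Matrix.of fun i l : Fin (D + 1) => φ i (Fin.cases x x' l)
    -- cofactors of the first column do not depend on the new point
    let d : Fin (D + 1) → K := fun i =>
      (Matrix.of fun i' l : Fin D => φ (i.succAbove i') (x' l)).det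
    have hexp : ∀ x, (N x).det = ∑ i : Fin (D + 1), ((-1) ^ (i : ℕ) * d i) * φ i x := by
      intro x
      rw [Matrix.det_succ_column_zero]
      refine Finset.sum_congr rfl fun i _ => ?_
      have hsub : (N x).submatrix i.succAbove Fin.succ = Matrix.of fun i' l : Fin D => φ (i.succAbove i') (x' l) := by
        ext i' l
        simp [N, Matrix.submatrix_apply]
      rw [hsub]
      simp only [N, Matrix.of_apply, Fin.cases_zero, d]
      ring
    have hd0 : d 0 ≠ 0 := by
      have : (Matrix.of fun i' l : Fin D => φ ((0 : Fin (D + 1)).succAbove i') (x' l)) =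
          Matrix.of fun i l : Fin D => φ i.succ (x' l) := by
        ext i' l
        simp
      simp only [d, this]
      exact hx'
    -- the combination is nontrivial, hence nonzero somewhere
    have hne : (fun x => ∑ i : Fin (D + 1), ((-1) ^ (i : ℕ) * d i) * φ i x) ≠ 0 := by
      intro h0
      have hcomb : ∑ i : Fin (D + 1), ((-1) ^ (i : ℕ) * d i) • φ i = 0 := by
        funext x
        have := congrFun h0 x
        simpa [Finset.sum_apply, Pi.smul_apply, smul_eq_mul] using this
      have hc := Fintype.linearIndependent_iff.mp hφ (fun i => (-1) ^ (i : ℕ) * d i) hcomb 0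
      simp only [Fin.val_zero, pow_zero, one_mul] at hc
      exact hd0 hc
    obtain ⟨x₀, hx₀⟩ : ∃ x₀, ∑ i : Fin (D + 1), ((-1) ^ (i : ℕ) * d i) * φ i x₀ ≠ 0 := by
      by_contra hall
      push Not at hall
      exact hne (funext hall)
    refine ⟨Fin.cases x₀ x', ?_⟩
    have hN : (Matrix.of fun i l : Fin (D + 1) => φ i (Fin.cases x₀ x' l)) = N x₀ := rfl
    rw [hN, hexp]
    exact hx₀

/-! ## Every multiplicity is realised by an untwisted certificate -/

/-- **Certificates exist in the size of the multiplicity.**  For a form `f` in variables `σ` and `m ≠ 0`,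
the multiplicity `D = mult_χ ℂ[Δ_m(f)]` is witnessed by highest-weight vectors `F₁ … F_D ∈ ℂ[Sym^m ℂ^σ]` of
weight `χ` and matrices `A₁ … A_D` with nonsingular evaluation matrix `(F_i(A_l · f))`: lift a basis of the
highest-weight space of `ℂ[Δ_m(f)]` to `ℂ[Sym^m]` (complete reducibility, `map_highestWeightSpace_eq_of_surjective`);
the functions `A ↦ F_i(A · f)` are linearly independent (a vanishing combination lies in `I(GL · f)`), so the
alternant lemma applies. [Mulmuley–Sohoni 2001 §4–5; Bläser–Ikenmeyer 2025 §12.4; folklore] -/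
theorem exists_certificate_orbitMultiplicity {σ : Type} [Fintype σ] [LinearOrder σ]
    (f : MvPolynomial σ ℂ) (m : ℕ) (hm : m ≠ 0) (χ : Weight σ) :
    ∃ (F : Fin (orbitMultiplicity ℂ f m χ) → MvPolynomial (DegIdx σ m) ℂ)
      (A : Fin (orbitMultiplicity ℂ f m χ) → Matrix σ σ ℂ),
      (∀ i, F i ∈ highestWeightSpace (coordRep σ ℂ m) χ) ∧
      (Matrix.of fun i l => MvPolynomial.aeval (formCoeff m (linSubst σ ℂ (A l) f)) (F i)).det ≠ 0 := by
  classical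
  haveI : FiniteDimensional ℂ (highestWeightSpace (orbitCoordRep f m) χ) :=
    finiteDimensional_highestWeightSpace_orbitCoordRep_holds (k := ℂ) f hm χ
  -- a basis of the highest-weight space of `ℂ[Δ_m(f)]`, indexed by `Fin D`
  let b := Module.finBasis ℂ (highestWeightSpace (orbitCoordRep f m) χ)
  have hD : Module.finrank ℂ (highestWeightSpace (orbitCoordRep f m) χ) = orbitMultiplicity ℂ f m χ := rfl
  -- lift the basis vectors to highest-weight vectors of `ℂ[Sym^m]`
  let mk : (coordRep σ ℂ m).IntertwiningMap (orbitCoordRep f m) :=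
    ⟨(Ideal.Quotient.mkₐ ℂ (orbitVanishingIdeal f m)).toLinearMap, fun _ => LinearMap.ext fun _ => rfl⟩
  have hsurj := map_highestWeightSpace_eq_of_surjective mk (Ideal.Quotient.mkₐ_surjective ℂ _)
    (isSemisimpleRepresentation_coordRep m) χ
  have hlift : ∀ i : Fin (orbitMultiplicity ℂ f m χ), ∃ F ∈ highestWeightSpace (coordRep σ ℂ m) χ,
      Ideal.Quotient.mkₐ ℂ (orbitVanishingIdeal f m) F = (b (Fin.cast hD.symm i) : OrbitCoordRing f m) := by
    intro i
    have hmem : ((b (Fin.cast hD.symm i) : highestWeightSpace (orbitCoordRep f m) χ) : OrbitCoordRing f m) ∈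
        (highestWeightSpace (coordRep σ ℂ m) χ).map mk.toLinearMap := by
      rw [hsurj]; exact (b _).2
    obtain ⟨F, hF, hFeq⟩ := Submodule.mem_map.mp hmem
    exact ⟨F, hF, hFeq⟩
  choose F hF hFeq using hlift
  -- the evaluation functions are linearly independent
  have hli : LinearIndependent ℂ (fun i : Fin (orbitMultiplicity ℂ f m χ) =>
      fun A : Matrix σ σ ℂ => MvPolynomial.aeval (formCoeff m (linSubst σ ℂ A f)) (F i)) := by
    rw [Fintype.linearIndependent_iff]
    intro c hc
    -- the combination `Σ c_i F_i` vanishes on `GL · f`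
    have hmem : ∑ i, c i • F i ∈ orbitVanishingIdeal f m := by
      rw [mem_orbitVanishingIdeal_iff]
      intro g
      have h := congrFun hc (g : Matrix σ σ ℂ)
      simp only [Finset.sum_apply, Pi.smul_apply, smul_eq_mul, Pi.zero_apply] at h
      rw [linSubstRep_apply, map_sum]
      simpa [map_smul, smul_eq_mul] using h
    -- so the corresponding combination of basis vectors vanishes
    have hcomb : ∑ i, c i • b (Fin.cast hD.symm i) = 0 := by
      apply Subtype.ext
      rw [Submodule.coe_sum, Submodule.coe_zero]
      simp only [Submodule.coe_smul, ← hFeq]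
      rw [← Ideal.Quotient.eq_zero_iff_mem, ← Ideal.Quotient.mkₐ_eq_mk ℂ, map_sum] at hmem
      simpa [map_smul] using hmem
    have hli_b : LinearIndependent ℂ (fun i : Fin (orbitMultiplicity ℂ f m χ) => b (Fin.cast hD.symm i)) :=
      b.linearIndependent.comp _ (Fin.cast_injective _)
    exact Fintype.linearIndependent_iff.mp hli_b c hcomb
  obtain ⟨A, hA⟩ := exists_det_eval_ne_zero_of_linearIndependent _ _ hli
  exact ⟨F, A, hF, hA⟩

end

end Summit.ValiantsHypothesis.ValiantsHypothesis.Theorems.ValuativeFlip
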